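import Summits.Ventures.PercRepro.PuncturedLYMTwoCoHypMain
import Summits.Ventures.PercRepro.PuncturedLYMCoHypMain
import Summits.Ventures.PercRepro.PuncturedLYMTwoCoHypCols
import Summits.Ventures.PercRepro.PuncturedLYMTwoCoHypPosLayer

/-!
# PercRepro — TWO DISJOINT CO-HYPERPLANES, PART 8: THE THEOREM — (SP) FOR `upLevel j C₁ ∪ upLevel j C₂` (p10, gen 35)

* `card_punctured_union_upLevel` — `#P + C(n − m₁, j − m₁) + C(n − m₂, j − m₂) = C(n, j)` for disjoint `C₁, C₂` with
  `#C₁ + #C₂ ≥ j + 2` (no `j`-set contains both);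
* **`puncturedNMP_union_upLevel`** — **the `j`-sets containing neither of two disjoint sets `C₁, C₂` with
  `1 ≤ #C₁, #C₂ ≤ j` and `#C₁ + #C₂ ≥ j + 2` have the normalised matching property against the level above, for
  every `2j + 1 ≤ n`**: the explicit flow of parts 6–7 (the superposition of the two one-co-hyperplane flows of gen 33
  corrected on the two boundary layers, proofs/P10-BOUNDARY-g34.md §2′ in the closed form of part 6) satisfies the
  row, column and positivity hypotheses of the master lemma `puncturedNMP_two_of_seq`.
For `#C₁ = #C₂ = j` this is (SP) for a two-word code with disjoint words; in general it is (SP) for the co-code of a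
paving matroid with exactly two nontrivial hyperplanes covering the ground set (part 9).  Nothing here asserts (SP),
(PAV) or (NC) in general.
-/

namespace PercRepro.PuncturedLYM

open Finset

variable {α : Type} [Fintype α] [DecidableEq α]

/-- No `j`-set contains both of two disjoint sets with `#C₁ + #C₂ ≥ j + 2`. -/
theorem disjoint_upLevel_of_big {j : ℕ} {C₁ C₂ : Finset α} (hdisj : Disjoint C₁ C₂)
    (hbig : j + 2 ≤ C₁.card + C₂.card) : Disjoint (upLevel j C₁) (upLevel j C₂) := by
  rw [disjoint_left]
  intro X h1 h2
  rw [mem_upLevel] at h1 h2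
  have := card_le_card (union_subset h1.2 h2.2)
  rw [card_union_of_disjoint hdisj, h1.1] at this
  omega

/-- **`#P + C(n − m₁, j − m₁) + C(n − m₂, j − m₂) = C(n, j)`** for `upLevel j C₁ ∪ upLevel j C₂`. -/
theorem card_punctured_union_upLevel {j : ℕ} {C₁ C₂ : Finset α} (hdisj : Disjoint C₁ C₂)
    (hm₁j : C₁.card ≤ j) (hm₂j : C₂.card ≤ j) (hbig : j + 2 ≤ C₁.card + C₂.card) :
    (punctured j (upLevel j C₁ ∪ upLevel j C₂)).card + (Fintype.card α - C₁.card).choose (j - C₁.card) +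
      (Fintype.card α - C₂.card).choose (j - C₂.card) = (Fintype.card α).choose j := by
  unfold punctured
  have hsub : upLevel j C₁ ∪ upLevel j C₂ ⊆ (univ : Finset α).powersetCard j := by
    intro X hX
    rw [mem_union, mem_upLevel, mem_upLevel] at hX
    rw [mem_powersetCard]
    rcases hX with h | h <;> exact ⟨subset_univ X, h.1⟩
  have h := card_sdiff_add_card_eq_card hsub
  rw [card_union_of_disjoint (disjoint_upLevel_of_big hdisj hbig), card_upLevel hm₁j, card_upLevel hm₂j,
    card_powersetCard, card_univ] at h
  omega

/-- **THE THEOREM: (SP) for the `j`-sets containing neither of two disjoint sets `C₁, C₂`** with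
`1 ≤ #C₁, #C₂ ≤ j`, `#C₁ + #C₂ ≥ j + 2` and `2j + 1 ≤ n`. -/
theorem puncturedNMP_union_upLevel {j : ℕ} {C₁ C₂ : Finset α} (hdisj : Disjoint C₁ C₂) (hm₁ : 1 ≤ C₁.card)
    (hm₁j : C₁.card ≤ j) (hm₂ : 1 ≤ C₂.card) (hm₂j : C₂.card ≤ j) (hbig : j + 2 ≤ C₁.card + C₂.card)
    (hn : 2 * j + 1 ≤ Fintype.card α) : PuncturedNMP j (upLevel j C₁ ∪ upLevel j C₂) := by
  set n := Fintype.card α with hn_def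
  set m₁ := C₁.card with hm₁_def
  set m₂ := C₂.card with hm₂_def
  have hm₁2 : 2 ≤ m₁ := by omega
  have hm₂2 : 2 ≤ m₂ := by omega
  have hjn : j < n := by omega
  apply puncturedNMP_two_of_seq hjn hdisj hbig (wA n j m₁ m₂) (wB n j m₁ m₂) (wR n j m₁ m₂) (twoK n j m₁ m₂)
  · -- `twoK · #Y = #P`
    have hY : (levelAbove α j).card = n.choose (j + 1) := by
      unfold levelAbove
      rw [card_powersetCard, card_univ]
    have hP := card_punctured_union_upLevel hdisj hm₁j hm₂j hbig
    have hPq : ((punctured j (upLevel j C₁ ∪ upLevel j C₂)).card : ℚ) =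
        (n.choose j : ℚ) - ((n - m₁).choose (j - m₁) : ℕ) - ((n - m₂).choose (j - m₂) : ℕ) := by
      have : ((punctured j (upLevel j C₁ ∪ upLevel j C₂)).card : ℚ) + ((n - m₁).choose (j - m₁) : ℕ) +
          ((n - m₂).choose (j - m₂) : ℕ) = (n.choose j : ℚ) := by exact_mod_cast hP
      linarith
    rw [hY, hPq]
    have hYpos : (0 : ℚ) < (n.choose (j + 1) : ℕ) := by exact_mod_cast Nat.choose_pos (by omega)
    have hr : (0 : ℚ) < ((n - j : ℕ) : ℚ) := by
      have : 1 ≤ n - j := by omega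
      exact_mod_cast this
    have hch := choose_succ_mul_eq n j
    unfold twoK coK coP
    field_simp
    linear_combination (-1 : ℚ) * hch
  · exact w_nonneg hm₁2 hm₁j hm₂2 hm₂j hbig hn
  · exact w_row hm₁2 hm₁j hm₂2 hm₂j hbig hn
  · intro a' b' ha hb hab _
    exact w_col hm₁2 hm₁j hm₂2 hm₂j hbig hn a' b' ha hb hab
  · intro b' _ _ _
    exact w_top₁ (by omega) b'
  · intro a' _ _ _
    exact w_top₂ (by omega) a'

end PercRepro.PuncturedLYM
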